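import Mathlib.Data.Nat.Digits.Lemmas
import Mathlib.Algebra.Order.Archimedean.Real.Basic
import Mathlib.Tactic.Linarith
import Mathlib.Tactic.Ring
import Mathlib.Tactic.NormNum
import Mathlib.Tactic.Push

/-!
# `SuperadditiveResistance` / Negative: dyadic doubling plus the series law is NOT sufficient

Support file (`--supports stmt-AtomisticToContinuum-11748`) for the crux
`JunctionLocality.SuperadditiveResistance` (bounded reservoir-insertion cost
`R_N + R_M - C ≤ R_{N+M}`, `R_N := (N-1)/D_N`), line `diagonal-split-series-law`
(`Cruxes/SuperadditiveResistance/Lines/diagonal_split_series_law.lean`, stubs `stub_evenDoubling` =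
bounded doubling defect `2R_N - C₁ ≤ R_{2N}` for ALL `N ≥ 2`, and `stub_quasiSubadditiveResistance` =
the series law `R_{N+M} ≤ R_N + R_M + C₂`; landed glue
`Theorems/JunctionLocalitySuperadditiveResistanceDiagonalSplit.lean`).

Question answered here (lead c26, reshaping audit): can the load-bearing stub `stub_evenDoubling` be
WEAKENED to its dyadic subsequence `N = 2^k` — the only lengths at which the dyadic iteration of the glue
(`le_of_doubling_of_tendsto_div`) is ever evaluated when started from a power of two — with the
composition kept (by the landed glue or by ANY shape-level argument)?  NO:
`dyadicDoubling_subadditive_not_sufficient` exhibits a positive length law `R_N = N + s₂(N)`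
(`s₂` = binary digit sum) that is EXACTLY subadditive (series law with constant `0`), has dyadic doubling
defect exactly `1` (`2R_{2^k} - 1 = R_{2^{k+1}}`), and yet has UNBOUNDED full doubling defect
`2R_N - R_{2N} = s₂(N)` and unbounded insertion defect `R_N + R_M - R_{N+M} = #carries(N + M)`
(both `= k` at `N = M = 2^k - 1`).  So at the level of shapes, "doubling along powers of two" together
with the series law and positivity does not give the crux's conclusion, and the registered signature of
`stub_evenDoubling` (all `N ≥ 2`) is already the weakest doubling statement the split can use; any
proof of the dyadic-only statement would still owe the odd-part content `s₂`.  (Companion of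
`doubling_not_sufficient` in `Cruxes/…/Lines/balanced-split-concavity-transfer.lean`, which shows that
full doubling WITHOUT the series law is not sufficient.)

Pure arithmetic; no dynamics, no new definitions besides the local abbreviation `(Nat.digits 2 ).sum`.
Lead seat prover-line-stmt-AtomisticToContinuum-11748-c26-0, 2026-08-17.
-/

namespace Summit.AtomisticToContinuum.FouriersLaw.Theorems.SuperadditiveResistance.Negative

/-- `s₂(0) = 0`. [folklore] -/
theorem binaryDigitSum_zero : (Nat.digits 2 0).sum = 0 := by
  simp

/-- `s₂(1) = 1`. [folklore] -/
theorem binaryDigitSum_one : (Nat.digits 2 1).sum = 1 := by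
  simp

/-- `s₂(2n + r) = s₂(n) + r` for a binary digit `r < 2` (appending one binary digit). [folklore] -/
theorem binaryDigitSum_two_mul_add (n r : ℕ) (hr : r < 2) :
    (Nat.digits 2 (2 * n + r)).sum = (Nat.digits 2 n).sum + r := by
  rcases Nat.eq_zero_or_pos (2 * n + r) with h0 | hpos
  · have hn : n = 0 := by omega
    have hr0 : r = 0 := by omega
    subst hn; subst hr0; simp
  · have h1 : (2 * n + r) % 2 = r := by omega
    have h2 : (2 * n + r) / 2 = n := by omega
    rw [Nat.digits_def' (by norm_num : 1 < 2) hpos, h1, h2, List.sum_cons]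
    omega

/-- `s₂(2n) = s₂(n)` (appending a binary zero; the `r = 0` case, kept private: the same statement is
`Summit.QuantumAdvantage.DigitPolyUniformity.SketchLAR.DoublingWeight.digits_sum_two_mul`). [folklore] -/
private theorem binaryDigitSum_two_mul (n : ℕ) :
    (Nat.digits 2 (2 * n)).sum = (Nat.digits 2 n).sum := by
  simpa using binaryDigitSum_two_mul_add n 0 (by norm_num)

/-- `s₂(2n + 1) = s₂(n) + 1` (appending a binary one; the `r = 1` case). [folklore] -/
theorem binaryDigitSum_two_mul_add_one (n : ℕ) :
    (Nat.digits 2 (2 * n + 1)).sum = (Nat.digits 2 n).sum + 1 :=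
  binaryDigitSum_two_mul_add n 1 (by norm_num)

/-- `s₂(2^k) = 1`. [folklore] -/
theorem binaryDigitSum_two_pow (k : ℕ) : (Nat.digits 2 (2 ^ k)).sum = 1 := by
  induction k with
  | zero => simp
  | succ k ih => rw [pow_succ, mul_comm, binaryDigitSum_two_mul, ih]

/-- `s₂(2^k - 1) = k` (the all-ones string). [folklore] -/
theorem binaryDigitSum_two_pow_sub_one (k : ℕ) : (Nat.digits 2 (2 ^ k - 1)).sum = k := by
  induction k with
  | zero => simp
  | succ k ih =>
    have hpos : 1 ≤ 2 ^ k := Nat.one_le_two_pow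
    have h : 2 ^ (k + 1) - 1 = 2 * (2 ^ k - 1) + 1 := by
      rw [pow_succ]; omega
    rw [h, binaryDigitSum_two_mul_add_one, ih]

/-- **Subadditivity of the binary digit sum**: `s₂(n + m) ≤ s₂(n) + s₂(m)` (each carry lowers the digit
sum by one).  Proof by strong induction on `n + m`, splitting both summands by parity. [folklore] -/
theorem binaryDigitSum_add_le (n m : ℕ) :
    (Nat.digits 2 (n + m)).sum ≤ (Nat.digits 2 n).sum + (Nat.digits 2 m).sum := by
  -- strong induction on the size `n + m`
  suffices H : ∀ S : ℕ, ∀ n m : ℕ, n + m ≤ S →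
      (Nat.digits 2 (n + m)).sum ≤ (Nat.digits 2 n).sum + (Nat.digits 2 m).sum from H (n + m) n m le_rfl
  intro S
  induction S with
  | zero =>
    intro n m h
    have hn : n = 0 := by omega
    have hm : m = 0 := by omega
    subst hn; subst hm; simp
  | succ S ih =>
    intro n m h
    rcases Nat.eq_zero_or_pos n with rfl | hn
    · simp
    rcases Nat.eq_zero_or_pos m with rfl | hm
    · simp
    -- write `n = 2a + r`, `m = 2b + t`
    obtain ⟨a, ha⟩ : ∃ a, n = 2 * a ∨ n = 2 * a + 1 := ⟨n / 2, by omega⟩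
    obtain ⟨b, hb⟩ : ∃ b, m = 2 * b ∨ m = 2 * b + 1 := ⟨m / 2, by omega⟩
    rcases ha with rfl | rfl <;> rcases hb with rfl | rfl
    · -- even + even
      have h1 : 2 * a + 2 * b = 2 * (a + b) := by ring
      rw [h1, binaryDigitSum_two_mul, binaryDigitSum_two_mul, binaryDigitSum_two_mul]
      exact ih a b (by omega)
    · -- even + odd
      have h1 : 2 * a + (2 * b + 1) = 2 * (a + b) + 1 := by ring
      rw [h1, binaryDigitSum_two_mul_add_one, binaryDigitSum_two_mul, binaryDigitSum_two_mul_add_one]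
      have := ih a b (by omega)
      omega
    · -- odd + even
      have h1 : 2 * a + 1 + 2 * b = 2 * (a + b) + 1 := by ring
      rw [h1, binaryDigitSum_two_mul_add_one, binaryDigitSum_two_mul, binaryDigitSum_two_mul_add_one]
      have := ih a b (by omega)
      omega
    · -- odd + odd: one carry
      have h1 : 2 * a + 1 + (2 * b + 1) = 2 * (a + (b + 1)) := by ring
      rw [h1, binaryDigitSum_two_mul, binaryDigitSum_two_mul_add_one, binaryDigitSum_two_mul_add_one]
      have h2 := ih a (b + 1) (by omega)
      have h3 : (Nat.digits 2 (b + 1)).sum ≤ (Nat.digits 2 b).sum + 1 := by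
        have h4 := ih b 1 (by omega)
        simpa using h4
      omega

/-- **Dyadic doubling plus the (exact) series law is not sufficient for the crux shape.**
The length law `R_N := N + s₂(N)` (`s₂` = binary digit sum) is positive, EXACTLY subadditive
(`R_{N+M} ≤ R_N + R_M`, i.e. the series law `stub_quasiSubadditiveResistance` with constant `0`), and has
dyadic doubling defect exactly `1` (`2R_{2^k} - 1 ≤ R_{2^{k+1}}`, in fact `=`); nevertheless its full
doubling defect `2R_N - R_{2N} = s₂(N)` is unbounded (so `stub_evenDoubling` fails for it) and its
insertion defect `R_N + R_M - R_{N+M}` is unbounded (so the crux's conclusion shape fails for it) — both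
witnessed at `N = M = 2^k - 1`.  Hence the doubling stub of line `diagonal-split-series-law` cannot be
weakened to powers of two at the level of shapes: the odd-part information is load-bearing. [folklore] -/
theorem dyadicDoubling_subadditive_not_sufficient :
    ∃ R : ℕ → ℝ,
      (∀ N : ℕ, 1 ≤ N → 0 < R N) ∧
      (∀ N M : ℕ, R (N + M) ≤ R N + R M) ∧
      (∀ k : ℕ, 2 * R (2 ^ k) - 1 ≤ R (2 ^ (k + 1))) ∧
      (¬ ∃ C : ℝ, ∀ N : ℕ, 2 ≤ N → 2 * R N - C ≤ R (2 * N)) ∧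
      ¬ ∃ C : ℝ, ∀ N M : ℕ, 2 ≤ N → 2 ≤ M → R N + R M - C ≤ R (N + M) := by
  refine ⟨fun N => (N : ℝ) + ((Nat.digits 2 N).sum : ℝ), ?_, ?_, ?_, ?_, ?_⟩
  · -- positivity
    intro N hN
    have : (1 : ℝ) ≤ N := by exact_mod_cast hN
    positivity
  · -- exact subadditivity
    intro N M
    have h := binaryDigitSum_add_le N M
    have h' : ((Nat.digits 2 (N + M)).sum : ℝ) ≤ (Nat.digits 2 N).sum + (Nat.digits 2 M).sum := by
      exact_mod_cast h
    push_cast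
    linarith
  · -- dyadic doubling with constant 1 (an equality)
    intro k
    simp only [binaryDigitSum_two_pow]
    push_cast
    ring_nf
    linarith
  · -- full doubling defect `s₂(N)` is unbounded
    rintro ⟨C, hC⟩
    obtain ⟨k, hk⟩ := exists_nat_gt (max C 2)
    have hk2 : 2 ≤ k := by
      have : (2 : ℝ) < k := lt_of_le_of_lt (le_max_right _ _) hk
      exact_mod_cast this.le
    have hCk : C < k := lt_of_le_of_lt (le_max_left _ _) hk
    -- N = 2^k - 1 ≥ 3
    have hpow : 4 ≤ 2 ^ k := by
      calc 4 = 2 ^ 2 := by norm_num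
        _ ≤ 2 ^ k := Nat.pow_le_pow_right (by norm_num) hk2
    have hN : 2 ≤ 2 ^ k - 1 := by omega
    have h := hC (2 ^ k - 1) hN
    dsimp only at h
    rw [binaryDigitSum_two_mul, binaryDigitSum_two_pow_sub_one] at h
    push_cast [Nat.one_le_two_pow] at h
    linarith
  · -- insertion defect `#carries` is unbounded: N = M = 2^k - 1
    rintro ⟨C, hC⟩
    obtain ⟨k, hk⟩ := exists_nat_gt (max C 2)
    have hk2 : 2 ≤ k := by
      have : (2 : ℝ) < k := lt_of_le_of_lt (le_max_right _ _) hk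
      exact_mod_cast this.le
    have hCk : C < k := lt_of_le_of_lt (le_max_left _ _) hk
    have hpow : 4 ≤ 2 ^ k := by
      calc 4 = 2 ^ 2 := by norm_num
        _ ≤ 2 ^ k := Nat.pow_le_pow_right (by norm_num) hk2
    have hN : 2 ≤ 2 ^ k - 1 := by omega
    have h := hC (2 ^ k - 1) (2 ^ k - 1) hN hN
    have hsum : 2 ^ k - 1 + (2 ^ k - 1) = 2 * (2 ^ k - 1) := by ring
    dsimp only at h
    rw [hsum, binaryDigitSum_two_mul, binaryDigitSum_two_pow_sub_one] at h
    push_cast [Nat.one_le_two_pow] at h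
    linarith

/-- The same witness read on response coefficients, in the crux's own variables: there is a POSITIVE
`D : ℕ → ℝ` whose resistances `R_N := (N-1)/D_N` obey the series law with constant `0` and the dyadic
doubling bound with constant `1`, but violate the crux's conclusion
`∃ C ∀ N M ≥ 2, R_N + R_M - C ≤ R_{N+M}` (and the full doubling bound).  Any proof of the crux through a
dyadic-only doubling statement must therefore use the dynamics beyond these shapes. [folklore] -/
theorem dyadicDoubling_subadditive_not_sufficient_D :
    ∃ D : ℕ → ℝ,
      (∀ N : ℕ, 2 ≤ N → 0 < D N) ∧
      (∀ N M : ℕ, 2 ≤ N → 2 ≤ M →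
        ((N : ℝ) + (M : ℝ) - 1) / D (N + M) ≤ ((N : ℝ) - 1) / D N + ((M : ℝ) - 1) / D M) ∧
      (∀ k : ℕ, 1 ≤ k →
        2 * (((2 ^ k : ℕ) : ℝ) - 1) / D (2 ^ k) - 1 ≤ (((2 ^ (k + 1) : ℕ) : ℝ) - 1) / D (2 ^ (k + 1))) ∧
      ¬ ∃ C : ℝ, ∀ N M : ℕ, 2 ≤ N → 2 ≤ M →
        ((N : ℝ) - 1) / D N + ((M : ℝ) - 1) / D M - C ≤ ((N : ℝ) + (M : ℝ) - 1) / D (N + M) := by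
  obtain ⟨R, hpos, hsub, hdy, -, hins⟩ := dyadicDoubling_subadditive_not_sufficient
  refine ⟨fun N => ((N : ℝ) - 1) / R N, ?_, ?_, ?_, ?_⟩
  · intro N hN
    have h1 : (0 : ℝ) < (N : ℝ) - 1 := by
      have : (2 : ℝ) ≤ N := by exact_mod_cast hN
      linarith
    exact div_pos h1 (hpos N (by omega))
  · intro N M hN hM
    have hRN := hpos N (by omega)
    have hRM := hpos M (by omega)
    have hRNM := hpos (N + M) (by omega)
    have h1 : (0 : ℝ) < (N : ℝ) - 1 := by
      have : (2 : ℝ) ≤ N := by exact_mod_cast hN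
      linarith
    have h2 : (0 : ℝ) < (M : ℝ) - 1 := by
      have : (2 : ℝ) ≤ M := by exact_mod_cast hM
      linarith
    have h3 : (0 : ℝ) < (N : ℝ) + (M : ℝ) - 1 := by linarith
    have e1 : ((N : ℝ) - 1) / (((N : ℝ) - 1) / R N) = R N := by
      field_simp
    have e2 : ((M : ℝ) - 1) / (((M : ℝ) - 1) / R M) = R M := by
      field_simp
    have e3 : ((N : ℝ) + (M : ℝ) - 1) / ((((N + M : ℕ) : ℝ) - 1) / R (N + M)) = R (N + M) := by
      push_cast
      field_simp
    dsimp only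
    rw [e1, e2, e3]
    exact hsub N M
  · intro k hk
    have hk1 : (2 : ℕ) ≤ 2 ^ k := by
      calc 2 = 2 ^ 1 := by norm_num
        _ ≤ 2 ^ k := Nat.pow_le_pow_right (by norm_num) hk
    have hR1 := hpos (2 ^ k) (by omega)
    have hR2 := hpos (2 ^ (k + 1)) (Nat.one_le_two_pow)
    have h1 : (0 : ℝ) < ((2 ^ k : ℕ) : ℝ) - 1 := by
      have : (2 : ℝ) ≤ ((2 ^ k : ℕ) : ℝ) := by exact_mod_cast hk1
      linarith
    have h2 : (0 : ℝ) < ((2 ^ (k + 1) : ℕ) : ℝ) - 1 := by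
      have hk2 : (2 : ℕ) ≤ 2 ^ (k + 1) := le_trans hk1 (Nat.pow_le_pow_right (by norm_num) (by omega))
      have : (2 : ℝ) ≤ ((2 ^ (k + 1) : ℕ) : ℝ) := by exact_mod_cast hk2
      linarith
    have e1 : 2 * (((2 ^ k : ℕ) : ℝ) - 1) / ((((2 ^ k : ℕ) : ℝ) - 1) / R (2 ^ k)) = 2 * R (2 ^ k) := by
      field_simp
    have e2 : (((2 ^ (k + 1) : ℕ) : ℝ) - 1) / ((((2 ^ (k + 1) : ℕ) : ℝ) - 1) / R (2 ^ (k + 1))) =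
        R (2 ^ (k + 1)) := by
      field_simp
    dsimp only
    rw [e1, e2]
    exact hdy k
  · rintro ⟨C, hC⟩
    apply hins
    refine ⟨C, fun N M hN hM => ?_⟩
    have hRN := hpos N (by omega)
    have hRM := hpos M (by omega)
    have hRNM := hpos (N + M) (by omega)
    have h1 : (0 : ℝ) < (N : ℝ) - 1 := by
      have : (2 : ℝ) ≤ N := by exact_mod_cast hN
      linarith
    have h2 : (0 : ℝ) < (M : ℝ) - 1 := by
      have : (2 : ℝ) ≤ M := by exact_mod_cast hM
      linarith
    have h3 : (0 : ℝ) < (N : ℝ) + (M : ℝ) - 1 := by linarith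
    have h := hC N M hN hM
    have e1 : ((N : ℝ) - 1) / (((N : ℝ) - 1) / R N) = R N := by
      field_simp
    have e2 : ((M : ℝ) - 1) / (((M : ℝ) - 1) / R M) = R M := by
      field_simp
    have e3 : ((N : ℝ) + (M : ℝ) - 1) / ((((N + M : ℕ) : ℝ) - 1) / R (N + M)) = R (N + M) := by
      push_cast
      field_simp
    dsimp only at h
    rw [e1, e2, e3] at h
    exact h

/-- `3 · 2^j` is not a power of two. [folklore] -/
theorem three_mul_two_pow_ne_two_pow (j k : ℕ) : 3 * 2 ^ j ≠ 2 ^ k := by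
  induction k generalizing j with
  | zero =>
    rw [pow_zero]
    have h1 : 1 ≤ 2 ^ j := Nat.one_le_two_pow
    omega
  | succ k ih =>
    cases j with
    | zero =>
      rw [pow_zero, pow_succ]
      omega
    | succ j =>
      rw [pow_succ, pow_succ]
      intro h
      exact ih j (by omega)

/-- **Two-sided dyadic control is not sufficient either** (stub 2 cannot be thinned to its diagonal).
The length law `R_N := N` for `N` a power of two and `R_N := 2N` otherwise is positive and EXACTLY
doubling-covariant (`R_{2N} = 2R_N`: both `stub_evenDoubling` and the diagonal `N = M` of the series law
hold with constant `0`), yet BOTH the series law `stub_quasiSubadditiveResistance`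
(`R_{2^{j+1}+2^j} − R_{2^{j+1}} − R_{2^j} = 3·2^j`) and the crux's conclusion shape
(`R_{3·2^j} + R_{2^j} − R_{2^{j+2}} = 3·2^j`) fail for it.  So the off-diagonal (lopsided) instances of the
series law are load-bearing in the split: `EvenDoubling` plus "even halving" `R_{2N} ≤ 2R_N + C` gives
nothing at the level of shapes. [folklore] -/
theorem twoSidedDoubling_not_sufficient :
    ∃ R : ℕ → ℝ,
      (∀ N : ℕ, 1 ≤ N → 0 < R N) ∧
      (∀ N : ℕ, R (2 * N) = 2 * R N) ∧
      (¬ ∃ C : ℝ, ∀ N M : ℕ, 2 ≤ N → 2 ≤ M → R (N + M) ≤ R N + R M + C) ∧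
      ¬ ∃ C : ℝ, ∀ N M : ℕ, 2 ≤ N → 2 ≤ M → R N + R M - C ≤ R (N + M) := by
  classical
  refine ⟨fun N => if ∃ k : ℕ, N = 2 ^ k then (N : ℝ) else 2 * (N : ℝ), ?_, ?_, ?_, ?_⟩
  · intro N hN
    have : (1 : ℝ) ≤ N := by exact_mod_cast hN
    dsimp only
    split_ifs <;> linarith
  · intro N
    dsimp only
    by_cases h : ∃ k : ℕ, N = 2 ^ k
    · obtain ⟨k, rfl⟩ := h
      have h2 : ∃ k' : ℕ, 2 * 2 ^ k = 2 ^ k' := ⟨k + 1, by ring⟩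
      rw [if_pos h2, if_pos ⟨k, rfl⟩]
      push_cast
      ring
    · have h2 : ¬ ∃ k' : ℕ, 2 * N = 2 ^ k' := by
        rintro ⟨k', hk'⟩
        rcases k' with _ | k'
        · rw [pow_zero] at hk'
          omega
        · exact h ⟨k', by rw [pow_succ] at hk'; omega⟩
      rw [if_neg h2, if_neg h]
      push_cast
      ring
  · rintro ⟨C, hC⟩
    obtain ⟨j, hj⟩ := exists_nat_gt (max C 1)
    have hj1 : 1 ≤ j := by
      have : (1 : ℝ) < j := lt_of_le_of_lt (le_max_right _ _) hj
      exact_mod_cast this.le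
    have hCj : C < j := lt_of_le_of_lt (le_max_left _ _) hj
    have hpow : 2 ≤ 2 ^ j := by
      calc 2 = 2 ^ 1 := by norm_num
        _ ≤ 2 ^ j := Nat.pow_le_pow_right (by norm_num) hj1
    have hjle : (j : ℝ) ≤ ((2 ^ j : ℕ) : ℝ) := by exact_mod_cast (Nat.lt_two_pow_self).le
    -- N = 2^(j+1), M = 2^j, N + M = 3·2^j
    have h := hC (2 ^ (j + 1)) (2 ^ j) (by rw [pow_succ]; omega) hpow
    have hsum : 2 ^ (j + 1) + 2 ^ j = 3 * 2 ^ j := by ring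
    dsimp only at h
    rw [hsum, if_neg (fun ⟨k, hk⟩ => three_mul_two_pow_ne_two_pow j k hk), if_pos ⟨j + 1, rfl⟩,
      if_pos ⟨j, rfl⟩] at h
    push_cast at h
    have : (0 : ℝ) < ((2 : ℝ) ^ j) := by positivity
    have hps : (2 : ℝ) ^ (j + 1) = 2 * 2 ^ j := by ring
    push_cast at hjle
    rw [hps] at h
    linarith
  · rintro ⟨C, hC⟩
    obtain ⟨j, hj⟩ := exists_nat_gt (max C 1)
    have hj1 : 1 ≤ j := by
      have : (1 : ℝ) < j := lt_of_le_of_lt (le_max_right _ _) hj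
      exact_mod_cast this.le
    have hCj : C < j := lt_of_le_of_lt (le_max_left _ _) hj
    have hpow : 2 ≤ 2 ^ j := by
      calc 2 = 2 ^ 1 := by norm_num
        _ ≤ 2 ^ j := Nat.pow_le_pow_right (by norm_num) hj1
    have hjle : (j : ℝ) ≤ ((2 ^ j : ℕ) : ℝ) := by exact_mod_cast (Nat.lt_two_pow_self).le
    -- N = 3·2^j, M = 2^j, N + M = 2^(j+2)
    have h := hC (3 * 2 ^ j) (2 ^ j) (by omega) hpow
    have hsum : 3 * 2 ^ j + 2 ^ j = 2 ^ (j + 2) := by ring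
    dsimp only at h
    rw [hsum, if_neg (fun ⟨k, hk⟩ => three_mul_two_pow_ne_two_pow j k hk), if_pos ⟨j, rfl⟩,
      if_pos ⟨j + 2, rfl⟩] at h
    push_cast at h
    have : (0 : ℝ) < ((2 : ℝ) ^ j) := by positivity
    have hps : (2 : ℝ) ^ (j + 2) = 4 * 2 ^ j := by ring
    push_cast at hjle
    rw [hps] at h
    linarith

end Summit.AtomisticToContinuum.FouriersLaw.Theorems.SuperadditiveResistance.Negative
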